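import Mathlib.LinearAlgebra.Matrix.ToLin
import Literature.NumberTheory.EllipticCurves.SupersingularDensitySerreProofs
import Literature.NumberTheory.EllipticCurves.SupersingularDensitySerreFrobeniusProofs
import Literature.NumberTheory.EllipticCurves.SupersingularDensitySerreTraceProofs
import Literature.NumberTheory.EllipticCurves.OpenImage
import Literature.NumberTheory.LFunctions.ChebotarevDensity
import HarnessLib

/-!
# Density `0` of the supersingular primes (Serre) — proofs, part 4: the count in `Aut(E[ℓ])`
# and the assembly from Chebotarev's theorem and Serre's open image theorem

Fourth `…Proofs` file (theorems only, nothing is defined) of the series on the named fact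
`WeierstrassCurve.serre_supersingular_density_zero` (`SupersingularDensity`; Serre 1981, §8,
Thm. 20 / Cor. 2: *for `E/ℚ` without complex multiplication the supersingular primes have natural
density `0`*).  Parts 1–3: `SupersingularDensitySerreProofs` (density calculus, `GL₂(𝔽_q)`
count), `SupersingularDensitySerreFrobeniusProofs` (Hasse, Serre's set),
`SupersingularDensitySerreTraceProofs` (`tr ρ̄_{E,ℓ}(σ_p) = a_p mod ℓ`, unramifiedness).

## Main result

`WeierstrassCurve.serre_supersingular_density_zero_of_chebotarev_of_openImage`: **Serre's
density-zero theorem follows from (i) the Chebotarev density theorem over `ℚ` in natural-density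
form and (ii) Serre's open image theorem** (the tree's named fact
`Literature.NumberTheory.EllipticCurves.serre_open_image`, Serre 1972, mod-`ℓ` surjectivity for
all large `ℓ`).  This is Serre's own proof (1981, p. 124: "Il est immédiat que `C_ℓ` est de mesure
nulle dans `G_ℓ`, ce qui entraîne (a) grâce au théorème de Chebotarev « qualitatif » (cf. n° 2.1,
th. 1)") in the variant of his Remarque 1 (p. 190: "A la place de la représentation `ℓ`-adique
`ρ_ℓ` (avec `ℓ` fixé), on peut utiliser les représentations `φ_ℓ` (avec `ℓ` variable) à valeurs
dans les groupes `GL₂(𝔽_ℓ)`"): for a prime `ℓ ≥ ℓ₀(E)` the representation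
`ρ̄_{E,ℓ} : Γ_ℚ → Aut(E[ℓ]) ≅ GL₂(𝔽_ℓ)` is onto; its trace-zero locus `C_ℓ` is stable under
conjugation and has `#C_ℓ / #GL₂(𝔽_ℓ) ≤ 4/ℓ` (`natCard_traceZero_addAut_div_le`, from part 1
through an explicit bijection `Aut(E[ℓ]) ≃ GL₂(𝔽_ℓ)` in a basis); every prime `p ≥ 5`, `p ≠ ℓ`,
of good supersingular reduction (`p ∣ a_p`, so `a_p = 0` by Hasse, part 2) is unramified in
`ℚ(E[ℓ])` with Frobenius class in `C_ℓ` (part 3, Serre's (238)); so by Chebotarev the good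
supersingular primes lie, up to `{2, 3, ℓ}`, in a set of natural density `#C_ℓ/#G_ℓ ≤ 4/ℓ`, for
every large prime `ℓ` — hence have density `0` (part 1, squeeze).

Hypothesis (i) is spelled out in the vocabulary of the tree's Dirichlet-density named fact
`Literature.NumberTheory.LFunctions.Chebotarev.dirichletDensity_eq` (`frobPrimes φ C`, `φ` onto a
finite group with open kernel, `C` conjugation-stable), with the conclusion
`HasPrimeDensity (frobPrimes φ C) (#C/#G)` — natural density, which is the sense of "densité" in
Serre's Théorème 1 (1981, §2.1, eq. (9): `π_C(x) = λ x/log x + o(x/log x)`).  The tree has (as of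
this file) no named fact for this natural-density form — the Dirichlet-density form bounds lower,
not upper, natural densities and does not suffice — so it enters as an explicit hypothesis; the
discharge `serre_supersingular_density_zero_holds` is exactly this theorem applied to that
statement and to `serre_open_image`, once both are theorems of the tree.

## References

* [Serre1981] J.-P. Serre, *Quelques applications du théorème de densité de Chebotarev*, Publ.
  Math. IHÉS 54 (1981): pp. 123–124 (statement (a) and its proof); §2.1 Thm. 1, eq. (9) (p. 131);
  §8.1 (238) (p. 188); Thm. 20, Cor. 2, Remarque 1 (pp. 189–190).
* [Serre1972] J.-P. Serre, *Propriétés galoisiennes des points d'ordre fini des courbes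
  elliptiques*, Invent. Math. 15 (1972), §4.2 Thm. 2 (the open image theorem, mod-`ℓ` form).
-/

noncomputable section

open scoped Classical NumberField
open Filter IsDedekindDomain Field

namespace Literature.NumberTheory.EllipticCurves

/-! ### The count in `Aut(A)`, `A ≅ 𝔽_ℓ²` -/

section Count

variable {ℓ : ℕ} [Fact ℓ.Prime] (A : Type) [AddCommGroup A] [Module (ZMod ℓ) A]

/-- An abelian group with `ℓ²` elements carrying an `𝔽_ℓ`-module structure is an `𝔽_ℓ`-plane.
[folklore] -/
theorem finrank_eq_two_of_natCard_eq_sq (hA : Nat.card A = ℓ ^ 2) : Module.finrank (ZMod ℓ) A = 2 := by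
  have hp : ℓ.Prime := Fact.out
  haveI : Finite A := Nat.finite_of_card_ne_zero (by rw [hA]; exact pow_ne_zero _ hp.ne_zero)
  haveI : Module.Finite (ZMod ℓ) A := Module.Finite.of_finite
  have h := Module.natCard_eq_pow_finrank (K := ZMod ℓ) (V := A)
  rw [hA, Nat.card_zmod] at h
  exact (Nat.pow_right_injective hp.two_le h).symm

/-- **`Aut(A) ≅ GL₂(𝔽_ℓ)` compatibly with traces, counted.**  For an `𝔽_ℓ`-plane `A` (an abelian
group with `ℓ²` elements and its `𝔽_ℓ`-module structure), the proportion of additive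
automorphisms of `A` whose (`𝔽_ℓ`-linear) trace vanishes is at most `4/ℓ`: a basis identifies
`Aut(A)` with `GL₂(𝔽_ℓ)` and the trace with the matrix trace, and `#{tr = 0}/#GL₂(𝔽_ℓ) ≤ 4/ℓ`
(`natCard_traceZeroGL2_div_le`, part 1).  Serre 1981, p. 124 ("`C_ℓ` est de mesure nulle dans
`G_ℓ`") at finite level. [cite: Serre1981, §8 Remarque 1 (p. 190)] -/
theorem natCard_traceZero_addAut_div_le (hA : Nat.card A = ℓ ^ 2) :
    (Nat.card {g : Multiplicative (AddAut A) |
        LinearMap.trace (ZMod ℓ) A ((Multiplicative.toAdd g).toAddMonoidHom.toZModLinearMap ℓ) = 0} : ℝ) /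
      Nat.card (Multiplicative (AddAut A)) ≤ 4 / ℓ := by
  have hp : ℓ.Prime := Fact.out
  haveI : Finite A := Nat.finite_of_card_ne_zero (by rw [hA]; exact pow_ne_zero _ hp.ne_zero)
  haveI : Module.Finite (ZMod ℓ) A := Module.Finite.of_finite
  let c : Module.Basis (Fin 2) (ZMod ℓ) A :=
    Module.finBasisOfFinrankEq (ZMod ℓ) A (finrank_eq_two_of_natCard_eq_sq A hA)
  -- additive automorphisms as linear maps
  let lin : AddAut A → (A →ₗ[ZMod ℓ] A) := fun e ↦ e.toAddMonoidHom.toZModLinearMap ℓ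
  have hlin : ∀ e x, lin e x = e x := fun e x ↦ rfl
  have hlin_comp_symm : ∀ e : AddAut A, (lin e).comp (lin e.symm) = LinearMap.id := fun e ↦
    LinearMap.ext fun x ↦ by simp [hlin]
  have hlin_symm_comp : ∀ e : AddAut A, (lin e.symm).comp (lin e) = LinearMap.id := fun e ↦
    LinearMap.ext fun x ↦ by simp [hlin]
  -- matrices as additive automorphisms
  let aut : GL (Fin 2) (ZMod ℓ) → AddAut A := fun M ↦
    { toFun := Matrix.toLin c c (M : Matrix (Fin 2) (Fin 2) (ZMod ℓ))
      invFun := Matrix.toLin c c ((M⁻¹ : GL (Fin 2) (ZMod ℓ)) : Matrix (Fin 2) (Fin 2) (ZMod ℓ))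
      left_inv := fun x ↦ by
        rw [← LinearMap.comp_apply, ← Matrix.toLin_mul c c c, Units.inv_mul, Matrix.toLin_one,
          LinearMap.id_apply]
      right_inv := fun x ↦ by
        rw [← LinearMap.comp_apply, ← Matrix.toLin_mul c c c, Units.mul_inv, Matrix.toLin_one,
          LinearMap.id_apply]
      map_add' := fun x y ↦ map_add _ x y }
  have haut : ∀ M, lin (aut M) = Matrix.toLin c c (M : Matrix (Fin 2) (Fin 2) (ZMod ℓ)) := fun M ↦
    LinearMap.ext fun x ↦ rfl
  -- the bijection `Aut(A) ≃ GL₂(𝔽_ℓ)`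
  let Φ : Multiplicative (AddAut A) ≃ GL (Fin 2) (ZMod ℓ) :=
    { toFun := fun g ↦
        { val := LinearMap.toMatrix c c (lin (Multiplicative.toAdd g))
          inv := LinearMap.toMatrix c c (lin (Multiplicative.toAdd g).symm)
          val_inv := by rw [← LinearMap.toMatrix_comp c c c, hlin_comp_symm, LinearMap.toMatrix_id]
          inv_val := by rw [← LinearMap.toMatrix_comp c c c, hlin_symm_comp, LinearMap.toMatrix_id] }
      invFun := fun M ↦ Multiplicative.ofAdd (aut M)
      left_inv := fun g ↦ by
        refine congrArg Multiplicative.ofAdd (AddEquiv.ext fun x ↦ ?_)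
        show Matrix.toLin c c (LinearMap.toMatrix c c (lin (Multiplicative.toAdd g))) x = _
        rw [Matrix.toLin_toMatrix]
        rfl
      right_inv := fun M ↦ Units.ext (by
        show LinearMap.toMatrix c c (lin (aut M)) = M
        rw [haut, LinearMap.toMatrix_toLin]) }
  have hΦ : ∀ g, ((Φ g : GL (Fin 2) (ZMod ℓ)) : Matrix (Fin 2) (Fin 2) (ZMod ℓ)) =
      LinearMap.toMatrix c c (lin (Multiplicative.toAdd g)) := fun g ↦ rfl
  -- transport the two cardinalities
  have hG : Nat.card (Multiplicative (AddAut A)) = Nat.card (GL (Fin 2) (ZMod ℓ)) :=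
    Nat.card_congr Φ
  have hC : Nat.card {g : Multiplicative (AddAut A) |
        LinearMap.trace (ZMod ℓ) A ((Multiplicative.toAdd g).toAddMonoidHom.toZModLinearMap ℓ) = 0} =
      Nat.card {g : GL (Fin 2) (ZMod ℓ) | Matrix.trace (g : Matrix (Fin 2) (Fin 2) (ZMod ℓ)) = 0} := by
    refine Nat.card_congr (Φ.subtypeEquiv fun g ↦ ?_)
    simp only [Set.mem_setOf_eq]
    rw [hΦ, ← LinearMap.trace_eq_matrix_trace (ZMod ℓ) c]
  rw [hG, hC]
  have h := natCard_traceZeroGL2_div_le (ZMod ℓ)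
  rwa [ZMod.card] at h

/-- The trace-zero locus of `Aut(A)` is stable under conjugation. [folklore] -/
theorem conj_mem_traceZero_addAut {g h : Multiplicative (AddAut A)}
    (hh : h ∈ {g : Multiplicative (AddAut A) |
      LinearMap.trace (ZMod ℓ) A ((Multiplicative.toAdd g).toAddMonoidHom.toZModLinearMap ℓ) = 0}) :
    g * h * g⁻¹ ∈ {g : Multiplicative (AddAut A) |
      LinearMap.trace (ZMod ℓ) A ((Multiplicative.toAdd g).toAddMonoidHom.toZModLinearMap ℓ) = 0} := by
  simp only [Set.mem_setOf_eq] at hh ⊢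
  let lin : AddAut A → (A →ₗ[ZMod ℓ] A) := fun e ↦ e.toAddMonoidHom.toZModLinearMap ℓ
  have hmul : ∀ a b : Multiplicative (AddAut A),
      lin (Multiplicative.toAdd (a * b)) = lin (Multiplicative.toAdd a) * lin (Multiplicative.toAdd b) :=
    fun a b ↦ LinearMap.ext fun x ↦ rfl
  have hone : lin (Multiplicative.toAdd g⁻¹) * lin (Multiplicative.toAdd g) = 1 := by
    rw [← hmul, inv_mul_cancel]
    exact LinearMap.ext fun x ↦ rfl
  show LinearMap.trace (ZMod ℓ) A (lin (Multiplicative.toAdd (g * h * g⁻¹))) = 0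
  rw [hmul, hmul, mul_assoc, LinearMap.trace_mul_comm, mul_assoc, hone, mul_one]
  exact hh

end Count

end Literature.NumberTheory.EllipticCurves

/-! ### The assembly -/

namespace WeierstrassCurve

open Literature.NumberTheory.EllipticCurves Literature.NumberTheory.GaloisRepresentations
  Literature.NumberTheory.LFunctions NumberField Rat.HeightOneSpectrum

/-- **Serre 1981, §8 (a) / Thm. 20, Cor. 2 ⇐ Chebotarev (natural density) + open image.**
Assume (i) the Chebotarev density theorem over `ℚ` in natural-density form — for every
surjection `φ : Γ_ℚ → G` onto a finite group with open kernel and every conjugation-stable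
`C ⊆ G`, the set `frobPrimes φ C` of primes unramified in `\bar ℚ^{ker φ}` with Frobenius class in
`C` has natural density `#C/#G` (Serre 1981, §2.1, Thm. 1, "densité" in the sense of eq. (9);
Chebotarev 1926; the vocabulary is that of the tree's `Chebotarev.dirichletDensity_eq`) — and
(ii) Serre's open image theorem in mod-`ℓ` form (`serre_open_image`: for `E/ℚ` without CM,
`ρ̄_{E,ℓ}` is onto `Aut(E[ℓ])` for all large primes `ℓ`; Serre 1972, §4.2, Thm. 2).  Then for every
elliptic curve `E/ℚ` without complex multiplication the good supersingular primes have natural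
density `0` — the named fact `serre_supersingular_density_zero`.  Proof (Serre 1981, p. 124 with
Remarque 1, p. 190): given `ε > 0` pick a prime `ℓ ≥ ℓ₀(E)` with `4/ℓ < ε`; the primes `p ≥ 5`,
`p ≠ ℓ`, of `goodSupersingularPrimes W` have `a_p = 0` (Hasse, part 2), are unramified in `ℚ(E[ℓ])`
and have Frobenius of trace `a_p ≡ 0 (mod ℓ)` on `E[ℓ]` (part 3), i.e. lie in
`frobPrimes ρ̄_{E,ℓ} C_ℓ`, `C_ℓ = {tr = 0} ⊆ Aut(E[ℓ])`, a set of natural density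
`#C_ℓ/#Aut(E[ℓ]) ≤ 4/ℓ < ε` by (i), (ii) and the count of part 1/`natCard_traceZero_addAut_div_le`;
conclude by the squeeze of part 1. [cite: Serre1981, pp. 123–124 (a), §2.1 Thm. 1, §8 Thm. 20 Cor. 2 and Remarque 1 (pp. 189–190)] -/
theorem serre_supersingular_density_zero_of_chebotarev_of_openImage
    (hC : ∀ ⦃G : Type⦄ [Group G] [Finite G] (φ : absoluteGaloisGroup ℚ →* G),
      IsOpen ((φ.ker : Subgroup (absoluteGaloisGroup ℚ)) : Set (absoluteGaloisGroup ℚ)) →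
      Function.Surjective φ →
      ∀ C : Set G, (∀ g h : G, h ∈ C → g * h * g⁻¹ ∈ C) →
        HasPrimeDensity (Chebotarev.frobPrimes φ C) ((Nat.card C : ℝ) / Nat.card G))
    (hS : serre_open_image) : serre_supersingular_density_zero := by
  intro W _ _ hCM
  obtain ⟨p₀, hp₀⟩ := hS W hCM
  refine hasPrimeDensity_zero_of_forall_exists_hasPrimeDensity_lt fun ε hε ↦ ?_
  -- a prime `ℓ ≥ p₀` with `4/ℓ < ε`
  obtain ⟨ℓ, hℓge, hℓ⟩ := Nat.exists_infinite_primes (max p₀ (⌈4 / ε⌉₊ + 1))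
  haveI := Fact.mk hℓ
  letI : Module (ZMod ℓ) (geomTorsion W ℓ) := AddSubgroup.torsionBy.zmodModule
  have hℓp₀ : p₀ ≤ ℓ := le_of_max_le_left hℓge
  have hℓε : (4 : ℝ) / ℓ < ε := by
    have h1 : (⌈4 / ε⌉₊ : ℝ) + 1 ≤ ℓ := by exact_mod_cast le_of_max_le_right hℓge
    have h2 : 4 / ε ≤ ⌈4 / ε⌉₊ := Nat.le_ceil _
    have hℓpos : (0 : ℝ) < ℓ := by exact_mod_cast hℓ.pos
    rw [div_lt_iff₀ hℓpos]
    calc (4 : ℝ) = 4 / ε * ε := by field_simp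
      _ < ℓ * ε := by nlinarith
      _ = ε * ℓ := mul_comm _ _
  -- the mod-`ℓ` representation, its image `G = Aut(E[ℓ])` and the trace-zero locus `C`
  have hℓ0 : ((ℓ : ℕ) : ℤ) ≠ 0 := by exact_mod_cast hℓ.ne_zero
  haveI : Finite (geomTorsion W ℓ) := finite_torsionPoints_holds W (AlgebraicClosure ℚ) hℓ0
  haveI : Finite (AddAut (geomTorsion W ℓ)) := Finite.of_injective _ AddEquiv.toEquiv_injective
  haveI : Finite (Multiplicative (AddAut (geomTorsion W ℓ))) :=
    Finite.of_equiv _ Multiplicative.ofAdd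
  set C : Set (Multiplicative (AddAut (geomTorsion W ℓ))) :=
    {g | LinearMap.trace (ZMod ℓ) (geomTorsion W ℓ)
      ((Multiplicative.toAdd g).toAddMonoidHom.toZModLinearMap ℓ) = 0} with hCdef
  have hker : IsOpen (((galoisRepTorsion W ℓ).ker : Subgroup (absoluteGaloisGroup ℚ)) :
      Set (absoluteGaloisGroup ℚ)) := isOpen_ker_galoisRepTorsion_holds W hℓ0
  have hsurj : Function.Surjective (galoisRepTorsion W ℓ) := hp₀ ℓ hℓ hℓp₀
  have hconj : ∀ g h : Multiplicative (AddAut (geomTorsion W ℓ)), h ∈ C → g * h * g⁻¹ ∈ C :=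
    fun g h hh ↦ conj_mem_traceZero_addAut (geomTorsion W ℓ) hh
  have hdens := hC (galoisRepTorsion W ℓ) hker hsurj C hconj
  have hcard : Nat.card (geomTorsion W ℓ) = ℓ ^ 2 :=
    card_torsionPoints_eq_sq_holds W (AlgebraicClosure ℚ) (n := ℓ) (by exact_mod_cast hℓ.ne_zero)
  refine ⟨Chebotarev.frobPrimes (galoisRepTorsion W ℓ) C, _, hdens,
    (natCard_traceZero_addAut_div_le (geomTorsion W ℓ) hcard).trans_lt hℓε, ?_⟩
  -- the good supersingular primes outside `frobPrimes` are among `{p < 5} ∪ {ℓ}`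
  refine ((Set.finite_lt_nat 5).union (Set.finite_singleton ℓ)).subset ?_
  rintro p ⟨hpSS, hpT⟩
  by_contra hnot
  simp only [Set.mem_union, Set.mem_setOf_eq, Set.mem_singleton_iff, not_or, not_lt] at hnot
  obtain ⟨hp5, hpℓ⟩ := hnot
  obtain ⟨hp, hgood, hdvd⟩ := hpSS
  have hap : W.frobeniusTrace p = 0 :=
    (W.natCast_dvd_frobeniusTrace_iff_eq_zero p hp5 hgood).mp hdvd
  obtain ⟨v, hv⟩ : ∃ v : HeightOneSpectrum (𝓞 ℚ), (primesEquiv v : ℕ) = p :=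
    ⟨primesEquiv.symm ⟨p, hp.out⟩, by rw [Equiv.apply_symm_apply]⟩
  exact hpT ⟨v, hv,
    fun 𝔓 h𝔓 σ hσ ↦ W.galoisRepTorsion_eq_one_of_mem_inertia_prime ℓ hpℓ hgood hv h𝔓 hσ,
    fun 𝔓 h𝔓 σ hσ ↦ W.trace_galoisRepTorsion_frobenius_eq_zero ℓ hpℓ hgood hap hv h𝔓 hσ⟩

end WeierstrassCurve
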